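import Summits.Ventures.PercRepro.OrbitK

/-!
# PercRepro — C-023′: the all-marked and the «skip `i + j = k + 1`» support statements of ORBIT-k (typer-2, gen 7)

mine-4 (g5, 14:32:42Z, `data/mine-4/g5/C023-K8-WITNESS.md`) killed the `k ≥ 8` extension of ORBIT-k (`C023Upper`,
the three-family constant on the pairs with `i + j ≥ k`) at `k = 8` with ONE UNMARKED vertex: on the 9-vertex graph
«6-cycle through an unmarked hub + three pendants» with marks `1..8`, `(2, 7)` reads `429 < 16 · 27 = 432` and
`(3, 6)` reads `257 < (10/3) · 79`. The row of record `C023` (`k ≤ 7`) stands. The lead (14:36:40Z, CONJECTURES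
v151) files two SUPPORT statements of the row — no new C-id — typed here 1-1:

* **`kappaAff i j k`** — the CURRENT constants of the cell's general-`k` layer (mine-4 kit j164209): the AFFINE value
  `Φ(k − i, k − j)` for `i + j ≤ k` (at `i + j = k` it is the three-family value `Φ(j, i)`: `kappaAff_eq_kappaK_of_add_eq`),
  and the three-family value `κ(i, j; k)` of `kappaK` for `i + j ≥ k + 1` (`kappaAff_eq_kappaK_of_le`);
  **`MultiGraph.OrbitKAff`** — the inequality `κ′ · a_ij ≤ Σ_{i<l<j} c_l` on one interval.
* **`C023AllMarked`** (C-023′, all-marked; lead ruling 14:43:59Z: `m` BIJECTIVE — `k = |V|`, one mark per vertex —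
  then `N(A)` is the number of open components and the statement is C-025 on cycle matroids, mine-2's PART 2 / PART 3
  of the C-023 row): every finite multigraph, every `k`, every bijective `k`-marking, every interval, every admissible
  pair. Support: k ≤ 9 on every 9-vertex graph with ≤ 20 edges (mine-4 14:53:35Z / 14:57:35Z, 0 violations).
* **`C023Skip`** (mine-4 14:38:19Z, §22 addendum): every `k`, EVERY marking, every admissible pair with `i + j ≠ k + 1`
  — the kill of `C023Upper` is exactly «`i + j = k + 1` with an unmarked hub»; clean on every census including j164209.
* **`C023Inj`** / **`C023SkipInj`** — the INJECTIVE-MARKING readings of the row of record `C023` and of `C023Skip`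
  (every census of the cell ran over injective markings; `C023Inj_of_C023`, `C023SkipInj_of_C023Skip`). The typed
  `C023` quantifies over arbitrary markings, which is a priori STRONGER: repeated marks do not change `N(A)` (the
  classes are read on the image of the marks), but the constant `κ(i, j; k)` is the one of the larger `k`; numerically
  `κ(i, j; k) ≤ κ(i, j; k′)` for `k′ < k ≤ 7` on every admissible pair (typer-2 g7, exact rationals, 0 exceptions; the
  same for `kappaAff` off `i + j = k + 1` up to `k = 11`), so the two readings are expected to be equivalent — the
  reduction (deduplicate the marking, compare the constants) is not in Lean.

The statements are conjectures of record for the planner (support cells of C-023); nothing is proved here beyond the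
consistency of the constants and the trivial implications.
-/

namespace PercRepro

/-- The current constant `κ′(i, j; k)` of the general-`k` layer: the affine value `Φ(k − i, k − j)` for
`i + j ≤ k`, the three-family value `κ(i, j; k)` otherwise. -/
def kappaAff (i j k : ℕ) : ℚ :=
  if i + j ≤ k then phiK (k - i) (k - j) else kappaK i j k

/-- For `i + j ≥ k + 1` the current constant is the three-family one. -/
theorem kappaAff_eq_kappaK_of_lt {i j k : ℕ} (h : k < i + j) : kappaAff i j k = kappaK i j k := by
  unfold kappaAff
  rw [if_neg (Nat.not_le.mpr h)]

/-- At `i + j = k` the affine value is the three-family value `Φ(j, i)`. -/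
theorem kappaAff_eq_kappaK_of_add_eq {i j k : ℕ} (h : i + j = k) : kappaAff i j k = kappaK i j k := by
  unfold kappaAff kappaK
  rw [if_pos h.le, if_pos h.le]
  subst h
  rw [Nat.add_sub_cancel_left, Nat.add_sub_cancel]

namespace MultiGraph

variable {V E : Type*} (G : MultiGraph V E) [DecidableEq V] [Fintype V] [Fintype E] [DecidableEq E]

/-- **ORBIT-k with the current constant** on one interval for the pair `(i, j)`:
`κ′(i, j; k) · a_ij ≤ Σ_{i<l<j} c_l` (in `ℚ`). -/
def OrbitKAff {k : ℕ} (m : Fin k → V) (I D : Config E) (i j : ℕ) : Prop :=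
  kappaAff i j k * (G.antipodalCount m I D i j : ℚ) ≤ ∑ l ∈ Finset.Ioo i j, (G.intervalCount m I D l : ℚ)

/-- `OrbitKAff` is decidable on finite data. -/
instance {k : ℕ} (m : Fin k → V) (I D : Config E) (i j : ℕ) : Decidable (G.OrbitKAff m I D i j) := by
  unfold OrbitKAff; infer_instance

/-- For `i + j ≥ k` the current constant agrees with `kappaK`, so `OrbitKAff` is `OrbitK`. -/
theorem orbitKAff_iff_orbitK_of_le {k : ℕ} (m : Fin k → V) (I D : Config E) {i j : ℕ} (h : k ≤ i + j) :
    G.OrbitKAff m I D i j ↔ G.OrbitK m I D i j := by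
  unfold OrbitKAff OrbitK
  rcases h.lt_or_eq with h | h
  · rw [kappaAff_eq_kappaK_of_lt h]
  · rw [kappaAff_eq_kappaK_of_add_eq h.symm]

end MultiGraph

/-- **C-023′, the ALL-MARKED form** (lead 14:36:40Z / 14:43:59Z; mine-2 PART 2 / PART 3 of the C-023 row): every
finite multigraph, every `k`, every BIJECTIVE `k`-marking `m` (`k = |V|`, one mark per vertex — the all-marked form
is C-025 on cycle matroids), every interval `[I, I ⊔ D]` and every pair `1 ≤ i`, `i + 2 ≤ j ≤ k`, with the current
constant `kappaAff`. -/
def C023AllMarked : Prop :=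
  ∀ {V E : Type} [DecidableEq V] [Fintype V] [Fintype E] [DecidableEq E] (G : MultiGraph V E)
    (k : ℕ) (m : Fin k → V), Function.Bijective m → ∀ (I D : Config E), I ⊓ D = ⊥ →
      ∀ i j : ℕ, 1 ≤ i → i + 2 ≤ j → j ≤ k → G.OrbitKAff m I D i j

/-- **C-023′, the «skip `i + j = k + 1`» form** (mine-4 14:38:19Z, §22 addendum; lead 14:54:29Z): the kill of
`C023Upper` is exactly «`i + j = k + 1` with an unmarked hub» — every finite multigraph, every `k`, EVERY
`k`-marking, every interval and every pair `1 ≤ i`, `i + 2 ≤ j ≤ k` with `i + j ≠ k + 1`, with the current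
constant `kappaAff` (the affine value for `i + j ≤ k`, `Φ(k + 1 − i, k + 1 − j)` for `i + j ≥ k + 2`). -/
def C023Skip : Prop :=
  ∀ {V E : Type} [DecidableEq V] [Fintype V] [Fintype E] [DecidableEq E] (G : MultiGraph V E)
    (k : ℕ) (m : Fin k → V) (I D : Config E), I ⊓ D = ⊥ →
      ∀ i j : ℕ, 1 ≤ i → i + 2 ≤ j → j ≤ k → i + j ≠ k + 1 → G.OrbitKAff m I D i j

/-- **The row of record `C023` read on INJECTIVE markings** (the convention of every census of the cell; lead
14:43:59Z): every finite multigraph, every `k ≤ 7`, every injective `k`-marking, every interval, every admissible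
pair, with the three-family constant `kappaK`. -/
def C023Inj : Prop :=
  ∀ {V E : Type} [DecidableEq V] [Fintype V] [Fintype E] [DecidableEq E] (G : MultiGraph V E)
    (k : ℕ), k ≤ 7 → ∀ (m : Fin k → V), Function.Injective m → ∀ (I D : Config E), I ⊓ D = ⊥ →
      ∀ i j : ℕ, 1 ≤ i → i + 2 ≤ j → j ≤ k → G.OrbitK m I D i j

/-- **`C023Skip` read on INJECTIVE markings** (the census convention). -/
def C023SkipInj : Prop :=
  ∀ {V E : Type} [DecidableEq V] [Fintype V] [Fintype E] [DecidableEq E] (G : MultiGraph V E)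
    (k : ℕ) (m : Fin k → V), Function.Injective m → ∀ (I D : Config E), I ⊓ D = ⊥ →
      ∀ i j : ℕ, 1 ≤ i → i + 2 ≤ j → j ≤ k → i + j ≠ k + 1 → G.OrbitKAff m I D i j

/-- The typed row `C023` (arbitrary markings) gives its injective reading. -/
theorem C023Inj_of_C023 (h : C023) : C023Inj :=
  fun G k hk m _ I D hID i j hi hij hj => h G k hk m I D hID i j hi hij hj

/-- `C023Skip` (arbitrary markings) gives its injective reading. -/
theorem C023SkipInj_of_C023Skip (h : C023Skip) : C023SkipInj :=
  fun G k m _ I D hID i j hi hij hj hk => h G k m I D hID i j hi hij hj hk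

/-- The all-marked form is the injective reading of `C023Skip`'s constant on bijective markings off
`i + j = k + 1` — in particular `C023SkipInj` gives `C023AllMarked` on those pairs. -/
theorem orbitKAff_of_C023SkipInj (h : C023SkipInj) {V E : Type} [DecidableEq V] [Fintype V] [Fintype E]
    [DecidableEq E] (G : MultiGraph V E) (k : ℕ) (m : Fin k → V) (hm : Function.Bijective m) (I D : Config E)
    (hID : I ⊓ D = ⊥) (i j : ℕ) (hi : 1 ≤ i) (hij : i + 2 ≤ j) (hj : j ≤ k) (hk : i + j ≠ k + 1) :
    G.OrbitKAff m I D i j :=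
  h G k m hm.1 I D hID i j hi hij hj hk

/-- The injective row implies `OrbitKAff` for `k ≤ 7` on the pairs with `i + j ≥ k` (the two constants agree
there). -/
theorem orbitKAff_of_C023Inj (h : C023Inj) {V E : Type} [DecidableEq V] [Fintype V] [Fintype E] [DecidableEq E]
    (G : MultiGraph V E) (k : ℕ) (hk : k ≤ 7) (m : Fin k → V) (hm : Function.Injective m) (I D : Config E)
    (hID : I ⊓ D = ⊥) (i j : ℕ) (hi : 1 ≤ i) (hij : i + 2 ≤ j) (hj : j ≤ k) (hk' : k ≤ i + j) :
    G.OrbitKAff m I D i j :=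
  (G.orbitKAff_iff_orbitK_of_le m I D hk').mpr (h G k hk m hm I D hID i j hi hij hj)

end PercRepro
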